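import Literature.Probability.Percolation.InterfaceScalingLimit
import HarnessLib

/-!
# Measurability of the triangular percolation interface (discharge of `aemeasurable_triInterface`)

Companion (theorems only) to `Literature.Probability.Percolation.InterfaceScalingLimit`.

The hexagonal exploration walk `explorationWalk D ω` takes values in the *countable* type
`Option (Σ f g : HexVertex, hexGraph.Walk f g)` (walks inject into lists of vertices,
`SimpleGraph.Walk.support_injective`), and each of its fibres is a countable Boolean combination
of the cylinder events `{ω | x ∈ ω}` (`measurable_set_mem`): being an exploration path for `ω` is a
statement about the colours `x ∈ D.bcConfig ω` of the sites along countably many darts. Hence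
every function of `explorationWalk D` — in particular `explorationCurve D` and the interface class
`triInterface D δ` — is measurable, with no admissibility, boundedness or `δ > 0` hypothesis and
without any topology on the target. (Aizenman–Burchard, Duke Math. J. 99 (1999), §2.1: the
interface laws `μ_δ` are probability measures on the curve space; Camia–Newman 2007, §2.)

Contents: `measurable_mem_bcConfig`, `measurable_isExplorationStep`, `measurable_isExplorationPath`,
`countable_sigma_hexWalk`, `measurableSet_explorationWalk_eq`, the factorisation principle
`measurable_of_explorationWalk`, `measurable_explorationCurve` (so `explorationLaw D p` is a genuine
push-forward), `measurable_triInterface`, and the discharge `aemeasurable_triInterface_holds`.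
Not here: the bond / medial analogue `aemeasurable_bondInterface` (the medial exploration of
`MedialInterface` is a different construction).

## References

* M. Aizenman, A. Burchard, *Hölder regularity and dimension bounds for random curves*, Duke
  Math. J. 99 (1999), 419–453, §2.1 (arXiv:math/9801027).
* F. Camia, C. M. Newman, *Critical percolation exploration path and SLE₆: a proof of
  convergence*, Probab. Theory Related Fields 139 (2007), §2.
-/

noncomputable section

open MeasureTheory

namespace Literature.Probability.Percolation

section Measurability

open LatticeModels

/-- The colour of a site under the Dobrushin boundary condition, `x ∈ D.bcConfig ω`, is a
measurable function of the configuration `ω` (it is `x ∈ A ∨ (x ∉ B ∧ x ∈ ω)`).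
(Camia–Newman 2007, §2; Aizenman–Burchard 1999, §2.1.) [cite: AizenmanBurchard1999, §2.1] -/
theorem measurable_mem_bcConfig (D : DiscreteDobrushin) (x : Site 2) :
    Measurable fun ω : SiteConfig (Site 2) => x ∈ D.bcConfig ω :=
  show Measurable fun ω : SiteConfig (Site 2) => x ∈ D.triArcA ∨ (x ∉ D.triArcB ∧ x ∈ ω) from
    measurable_const.or (measurable_const.and (measurable_set_mem x))

/-- Being an exploration step `f → g` is a measurable event (a countable union over the darts of
`𝕋` of events depending on two sites). (Camia–Newman 2007, §2; Aizenman–Burchard 1999, §2.1.) [cite: AizenmanBurchard1999, §2.1] -/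
theorem measurable_isExplorationStep (D : DiscreteDobrushin) (f g : HexVertex) :
    Measurable fun ω : SiteConfig (Site 2) => IsExplorationStep D ω f g := by
  haveI : Countable triGraph.Dart := SimpleGraph.Dart.toProd_injective.countable
  show Measurable fun ω : SiteConfig (Site 2) => ∃ e : triGraph.Dart, triEdgeFaces e = (g, f) ∧
    (triDiscreteDomainGraph D.Ω D.δ).Adj e.fst e.snd ∧ e.fst ∈ D.bcConfig ω ∧ e.snd ∉ D.bcConfig ω
  exact Measurable.exists fun e => measurable_const.and <| measurable_const.and <|
    (measurable_mem_bcConfig D e.fst).and (measurable_mem_bcConfig D e.snd).not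

/-- Being the exploration path is a measurable event, for every fixed walk `γ` (countable
intersections over darts and faces of exploration-step events). (Camia–Newman 2007, §2;
Aizenman–Burchard 1999, §2.1.) [cite: AizenmanBurchard1999, §2.1] -/
theorem measurable_isExplorationPath (D : DiscreteDobrushin) {f g : HexVertex}
    (γ : hexGraph.Walk f g) :
    Measurable fun ω : SiteConfig (Site 2) => IsExplorationPath D ω γ := by
  haveI : Countable hexGraph.Dart := SimpleGraph.Dart.toProd_injective.countable
  have h : (fun ω : SiteConfig (Site 2) => IsExplorationPath D ω γ) = fun ω => γ.IsPath ∧ f ≠ g ∧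
      (∀ d : hexGraph.Dart, d ∈ γ.darts → IsExplorationStep D ω d.fst d.snd) ∧
      (∀ h, ¬ IsExplorationStep D ω h f) ∧ ∀ h, ¬ IsExplorationStep D ω g h := by
    funext ω
    exact propext ⟨fun ⟨h1, h2, h3, h4, h5⟩ => ⟨h1, h2, h3, h4, h5⟩,
      fun ⟨h1, h2, h3, h4, h5⟩ => ⟨h1, h2, h3, h4, h5⟩⟩
  rw [h]
  exact measurable_const.and <| measurable_const.and <|
    (Measurable.forall fun d : hexGraph.Dart =>
      measurable_const.imp (measurable_isExplorationStep D d.fst d.snd)).and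
    <| (Measurable.forall fun h : HexVertex => (measurable_isExplorationStep D h f).not).and
    (Measurable.forall fun h : HexVertex => (measurable_isExplorationStep D g h).not)

/-- The type of hexagonal walks with their endpoints is countable (walks inject into lists of
faces by `SimpleGraph.Walk.support_injective`). (Camia–Newman 2007, §2: lattice paths.) [cite: CamiaNewman2007, §2] -/
theorem countable_sigma_hexWalk : Countable (Σ f g : HexVertex, hexGraph.Walk f g) := by
  haveI : ∀ f g : HexVertex, Countable (hexGraph.Walk f g) := fun _ _ =>
    SimpleGraph.Walk.support_injective.countable
  infer_instance

/-- Every fibre `{ω | explorationWalk D ω = a}` of the exploration walk is a measurable event: for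
`a = some γ` it is "`γ` is an exploration path and every exploration path equals `γ`", for
`a = none` it is the complement of "there is exactly one exploration path", both countable
Boolean combinations of the events `measurable_isExplorationPath`. (Camia–Newman 2007, §2;
Aizenman–Burchard 1999, §2.1.) [cite: AizenmanBurchard1999, §2.1] -/
theorem measurableSet_explorationWalk_eq (D : DiscreteDobrushin)
    (a : Option (Σ f g : HexVertex, hexGraph.Walk f g)) :
    MeasurableSet {ω : SiteConfig (Site 2) | explorationWalk D ω = a} := by
  haveI := countable_sigma_hexWalk
  have hP : ∀ γ : Σ f g : HexVertex, hexGraph.Walk f g,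
      Measurable fun ω : SiteConfig (Site 2) => IsExplorationPath D ω γ.2.2 := fun γ =>
    measurable_isExplorationPath D γ.2.2
  have hU : ∀ γ : Σ f g : HexVertex, hexGraph.Walk f g,
      Measurable fun ω : SiteConfig (Site 2) => IsExplorationPath D ω γ.2.2 ∧
        ∀ γ' : Σ f g : HexVertex, hexGraph.Walk f g, IsExplorationPath D ω γ'.2.2 → γ' = γ :=
    fun γ => (hP γ).and (Measurable.forall fun γ' => (hP γ').imp measurable_const)
  cases a with
  | none =>
    have : {ω : SiteConfig (Site 2) | explorationWalk D ω = none} =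
        {ω | ¬ ∃ γ : Σ f g : HexVertex, hexGraph.Walk f g, IsExplorationPath D ω γ.2.2 ∧
          ∀ γ' : Σ f g : HexVertex, hexGraph.Walk f g, IsExplorationPath D ω γ'.2.2 → γ' = γ} := by
      ext ω
      simp only [Set.mem_setOf_eq]
      unfold explorationWalk
      by_cases h : ∃! γ : Σ f g : HexVertex, hexGraph.Walk f g, IsExplorationPath D ω γ.2.2
      · rw [dif_pos h]
        exact ⟨fun h' => (Option.some_ne_none _ h').elim, fun h' => (h' h).elim⟩
      · rw [dif_neg h]
        exact ⟨fun _ => h, fun _ => rfl⟩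
    rw [this]
    exact (Measurable.exists hU).not.setOf
  | some γ =>
    have : {ω : SiteConfig (Site 2) | explorationWalk D ω = some γ} =
        {ω | IsExplorationPath D ω γ.2.2 ∧
          ∀ γ' : Σ f g : HexVertex, hexGraph.Walk f g, IsExplorationPath D ω γ'.2.2 → γ' = γ} := by
      ext ω
      simp only [Set.mem_setOf_eq]
      unfold explorationWalk
      by_cases h : ∃! γ : Σ f g : HexVertex, hexGraph.Walk f g, IsExplorationPath D ω γ.2.2
      · rw [dif_pos h]
        refine ⟨fun hγ => ?_, fun hγ => congrArg some (hγ.2 _ h.exists.choose_spec)⟩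
        obtain rfl := Option.some.inj hγ
        exact ⟨h.exists.choose_spec, fun γ' hγ' => h.unique hγ' h.exists.choose_spec⟩
      · rw [dif_neg h]
        exact ⟨fun h' => (Option.some_ne_none γ h'.symm).elim, fun hγ => (h ⟨γ, hγ.1, hγ.2⟩).elim⟩
    rw [this]
    exact (hU γ).setOf

/-- **Factorisation principle.** Any function of the configuration that depends on `ω` only
through the exploration walk `explorationWalk D ω` is measurable: the walk type is countable and
the fibres are measurable (`measurableSet_explorationWalk_eq`), so the function is a composition
of a measurable map into a countable discrete space with an arbitrary map. No hypothesis on `D`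
and no structure on the target are needed. (Aizenman–Burchard 1999, §2.1; Camia–Newman 2007,
§2.) [cite: AizenmanBurchard1999, §2.1] -/
theorem measurable_of_explorationWalk {X : Type*} [MeasurableSpace X] (D : DiscreteDobrushin)
    {F : SiteConfig (Site 2) → X}
    (hF : ∀ ω ω', explorationWalk D ω = explorationWalk D ω' → F ω = F ω') : Measurable F := by
  classical
  haveI := countable_sigma_hexWalk
  letI : MeasurableSpace (Option (Σ f g : HexVertex, hexGraph.Walk f g)) := ⊤
  let g : Option (Σ f g : HexVertex, hexGraph.Walk f g) → X := fun a =>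
    F (if h : ∃ ω, explorationWalk D ω = a then h.choose else ∅)
  have hFg : F = g ∘ explorationWalk D := by
    funext ω
    have h : ∃ ω', explorationWalk D ω' = explorationWalk D ω := ⟨ω, rfl⟩
    simp only [Function.comp_apply, g, dif_pos h]
    exact hF _ _ h.choose_spec.symm
  rw [hFg]
  exact measurable_from_top.comp
    (measurable_to_countable' fun a => measurableSet_explorationWalk_eq D a)

/-- Configurations with the same exploration walk have the same exploration curve.
(Camia–Newman 2007, §2.) [cite: CamiaNewman2007, §2] -/
theorem explorationCurve_congr {D : DiscreteDobrushin} {ω ω' : SiteConfig (Site 2)}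
    (h : explorationWalk D ω = explorationWalk D ω') :
    explorationCurve D ω = explorationCurve D ω' := by
  unfold explorationCurve
  rw [h]

/-- The exploration curve `explorationCurve D : SiteConfig (Site 2) → C([0,1], ℂ)` is measurable
for the Borel σ-algebra of the uniform topology (`curveMeasurableSpace`), for every `D` — so
`explorationLaw D p` is a genuine push-forward. (Camia–Newman 2007, §2; Aizenman–Burchard 1999,
§2.1.) [cite: AizenmanBurchard1999, §2.1] -/
theorem measurable_explorationCurve (D : DiscreteDobrushin) : Measurable (explorationCurve D) :=
  measurable_of_explorationWalk D fun _ _ h => explorationCurve_congr h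

/-- The triangular interface `triInterface D δ : SiteConfig (Site 2) → CurveClass ℂ` is (Borel)
measurable, for every Dobrushin domain `D` and every real `δ`. (Aizenman–Burchard 1999, §2.1;
Camia–Newman 2007, §2.) [cite: AizenmanBurchard1999, §2.1] -/
theorem measurable_triInterface (D : RandomPlanarGeometry.DobrushinDomain) (δ : ℝ) :
    Measurable (triInterface D δ) :=
  measurable_of_explorationWalk (dobrushinData D δ) fun ω ω' h => by
    rw [triInterface, triInterface, explorationCurve_congr h]

/-- **Discharge of `aemeasurable_triInterface`** (crit-perc.S26, measurability half): the
site-percolation interface on `δ𝕋` is a.e.-measurable under critical site percolation — in fact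
measurable (`measurable_triInterface`), under any measure. (Aizenman–Burchard, Duke Math. J. 99
(1999), §2.1: interface laws as Borel probability measures on the space of curves; Camia–Newman,
PTRF 139 (2007), §2.) [cite: AizenmanBurchard1999, §2.1] -/
theorem aemeasurable_triInterface_holds : aemeasurable_triInterface :=
  fun D δ => (measurable_triInterface D δ).aemeasurable

end Measurability

end Literature.Probability.Percolation
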